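import Summits.ResolutionOfSingularities.ResolutionOfSingularities.Theorems.EquisingularLiftEquisingularLiftNatFanGameWallsKeep
import HarnessLib

/-!
# [OURS · L1 W4.5(b) · EL♮(3) · D-0157 DOOR 1, WIDTH row iso-w4] FAN-GAME WINNABILITY IN DIMENSION THREE — brick 2d: conclusion and assembly

res-L1-w45b-iso-w4 g0 (prover, width seat; desk WIDTH TABLE D1/D1′; referee crit-2). `--supports stmt-ResolutionOfSingularities-20148 --as helper`.
Sorry-free, fact-free, def-free. OURS; counted 0; AI kernel work, weaker than expert review; NOT a statement of any manuscript; nothing of [Hironaka2017]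
is used; resolution of singularities in characteristic `p` is NOT proved here or anywhere in this chain.
Blueprint: `L/res-L1-w45b-iso-w4/FANGAME-MEMO.md` §6 («NODES FIRST, THEN WALLS»).

## What is proved

* `FanGame.exists_wcross_of_bad_pair` (c1) — a `Bad` pair of rays yields a W-crossing pair (TAKEOVER along the edge).
* ★ `FanGame.not_bad_of_noWCross` (c2) — in a separated position of smooth cones (≤ 3 rays) in which every node direction is a ray and no pair of
  exponents has a W-crossing pair in `σ`, the cone `σ` is good: otherwise two TAKEOVERs (first with the table of minimisers at a vertex `q` along the
  opposite edge, then with the full table along the wall leaving `q`) produce a node point INSIDE `σ`, contradicting FAN EXCLUSION + independence.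
* `FanGame.phase2_all` — PHASE 2 for all ordered pairs (fold; earlier walls kept by `noWCross_of_reach`).
* ★★★ `FanGame.fanGameWinnable_three` — **FAN-GAME WINNABILITY, `n = 3`** (`FanGameLocal 3` shape): for every non-empty table `V ⊂ ℕ³`, from every
  position reachable from `orthantFan 3` some E1-legal sequence of stars reaches a `Won` position; `fanGameWinnable_three_orthant` = the row's
  statement (convenience is not needed).
* ★★ `localNDWon_of_localND_three` (`LocalND g → LocalNDWon g` for `g : MvPolynomial (Fin 3) k`) and ★★ `isoHypNDWon_of_isoHypND_three` /
  `not_isoHypND_of_not_isoHypNDWon_three` — at `n = 3` the won play of the registered ND stub's hypothesis `IsoHypNDWon` is FREE, and the iso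
  residue's `¬ IsoHypNDWon k 3 H ι` is equivalent to `¬ IsoHypND k 3 H ι` (the re-cut this row was minted to feed).

What this is NOT: it is the combinatorial (toric, E1-legal principalisation) layer only; nothing here resolves a non-Newton-nondegenerate singularity,
and `EquisingularLiftNatThree` is NOT proved.
-/

set_option linter.dupNamespace false

open Matrix

namespace Summit.ResolutionOfSingularities.ResolutionOfSingularities.Cruxes.EquisingularLiftNat.Sections

namespace FanGame

/-! ### The conclusion: after PHASE 1 and PHASE 2 for every pair, every cone is good -/

/-- **(c1) A `Bad` pair yields a W-crossing pair.**  For `Bad V {p, q}`: `m₀ :=` the minimiser at `p` that is best at `q`, TAKEOVER along `[p, q]`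
gives `m₁` with `{q, p}` W-crossing for `(m₀, m₁)`. [OURS · L1 W4.5b · brick 2d] -/
theorem exists_wcross_of_bad_pair {V : Finset (Fin 3 → ℕ)} (hV : V.Nonempty) {p q : Ray 3} (hB : Bad V ({p, q} : Finset (Ray 3))) :
    ∃ m₀ ∈ V, ∃ m₁ ∈ V, m₀ ≠ m₁ ∧ WCross V m₀ m₁ q p := by
  classical
  -- minimisers at `p`, and among them the best at `q`
  set Ap := V.filter (fun m => ∀ m' ∈ V, pair p m ≤ pair p m') with hAp
  have hApne : Ap.Nonempty := by
    obtain ⟨m, hm, hmin⟩ := V.exists_min_image (fun m => pair p m) hV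
    exact ⟨m, Finset.mem_filter.2 ⟨hm, hmin⟩⟩
  obtain ⟨m₀, hm₀Ap, hm₀min⟩ := Ap.exists_min_image (fun m => pair q m) hApne
  obtain ⟨hm₀V, hm₀p⟩ := Finset.mem_filter.1 hm₀Ap
  -- `m₀` is not minimal at `q`
  have hmb : ∃ m' ∈ V, pair q m' < pair q m₀ := by
    by_contra h; push Not at h
    exact hB ⟨m₀, hm₀V, fun ρ hρ m' hm' => by
      simp only [Finset.mem_insert, Finset.mem_singleton] at hρ
      rcases hρ with rfl | rfl
      · exact hm₀p m' hm'
      · exact h m' hm'⟩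
  obtain ⟨m₁, hm₁, A, B, hA, hBpos, hAeq, hBeq, hminy, htie⟩ := takeover V p q hm₀p hmb
  -- `A > 0`: else `m₁` is a minimiser at `p` better than `m₀` at `q`
  have hApos : 0 < A := by
    rcases hA.lt_or_eq with h | h
    · exact h
    · exfalso
      have hm₁Ap : m₁ ∈ Ap := Finset.mem_filter.2 ⟨hm₁, fun m' hm' => by rw [hAeq, ← h, add_zero]; exact hm₀p m' hm'⟩
      have := hm₀min m₁ hm₁Ap
      linarith
  refine ⟨m₀, hm₀V, m₁, hm₁, fun h => by subst h; linarith, ?_, ?_, ?_⟩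
  · rw [lin_zOf]; linarith
  · rw [lin_zOf]; linarith
  · have hx : xPt m₀ m₁ q p = B • p + A • q := by
      rw [xPt, lin_zOf, lin_zOf, show pair q m₀ - pair q m₁ = B by linarith, show -(pair p m₀ - pair p m₁) = A by linarith]
    rw [hx]; exact hminy

/-- Sum of a function supported on three distinct members of a finset. -/
theorem sum_three {σ : Finset (Ray 3)} {p q r : Ray 3} (hp : p ∈ σ) (hq : q ∈ σ) (hr : r ∈ σ) (hpq : p ≠ q) (hqr : q ≠ r) (hrp : r ≠ p)
    (f : Ray 3 → ℤ) (hf : ∀ x ∈ σ, x ≠ p → x ≠ q → x ≠ r → f x = 0) :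
    ∑ x ∈ σ, f x • x = f p • p + f q • q + f r • r := by
  classical
  have hsub : ({p, q, r} : Finset (Ray 3)) ⊆ σ := by
    intro x hx; simp only [Finset.mem_insert, Finset.mem_singleton] at hx
    rcases hx with rfl | rfl | rfl <;> assumption
  rw [← Finset.sum_subset hsub (fun x hx hx' => by
    simp only [Finset.mem_insert, Finset.mem_singleton, not_or] at hx'
    rw [hf x hx hx'.1 hx'.2.1 hx'.2.2, zero_smul])]
  rw [Finset.sum_insert (by simp [hpq, hrp.symm]), Finset.sum_insert (by simp [hqr]), Finset.sum_singleton, add_assoc]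

/-- **(c2) + (c1): after both phases every cone is good.**  In a separated position of smooth cones (≤ 3 rays) in which every node direction is a ray
and NO pair of exponents has a W-crossing pair in `σ`, the cone `σ` is not `Bad`. [OURS · L1 W4.5b · brick 2d] -/
theorem not_bad_of_noWCross {V : Finset (Fin 3 → ℕ)} (hV : V.Nonempty) {F : Finset (Finset (Ray 3))} (hSep : Separated F)
    (hN : NodesResolved V F) {σ : Finset (Ray 3)} (hσF : σ ∈ F) (hσ : ND.IsSmoothCone σ) (hcard : σ.card ≤ 3)
    (hall : ∀ m ∈ V, ∀ m' ∈ V, m ≠ m' → ∀ u ∈ σ, ∀ v ∈ σ, ¬ WCross V m m' u v) : ¬ Bad V σ := by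
  classical
  intro hBad
  -- every pair of rays of `σ` has a common minimiser
  have hgood : ∀ u ∈ σ, ∀ v ∈ σ, ∃ m ∈ V, (∀ m' ∈ V, pair u m ≤ pair u m') ∧ (∀ m' ∈ V, pair v m ≤ pair v m') := by
    intro u hu v hv
    by_contra h
    push Not at h
    have hB : Bad V ({u, v} : Finset (Ray 3)) := by
      rintro ⟨m, hm, hmin⟩
      obtain ⟨m', hm', hlt⟩ := h m hm (fun m' hm' => hmin u (by simp) m' hm')
      exact absurd (hmin v (by simp) m' hm') (not_le.2 hlt)
    obtain ⟨m₀, hm₀, m₁, hm₁, hne, hW⟩ := exists_wcross_of_bad_pair hV hB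
    exact hall m₀ hm₀ m₁ hm₁ hne v hv u hu hW
  -- three distinct rays
  obtain ⟨p, hp⟩ : σ.Nonempty := by
    by_contra h; rw [Finset.not_nonempty_iff_eq_empty] at h; subst h
    obtain ⟨m, hm⟩ := hV
    exact hBad ⟨m, hm, fun ρ hρ => absurd hρ (Finset.notMem_empty _)⟩
  have key3 : ∃ q ∈ σ, ∃ r ∈ σ, p ≠ q ∧ q ≠ r ∧ r ≠ p := by
    by_contra h
    push Not at h
    -- then `σ ⊆ {p, q}` for some `q`, and a common minimiser of `{p, q}` is one of `σ`
    have : ∃ q ∈ σ, ∀ x ∈ σ, x = p ∨ x = q := by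
      by_cases h2 : ∃ q ∈ σ, q ≠ p
      · obtain ⟨q, hq, hqp⟩ := h2
        refine ⟨q, hq, fun x hx => ?_⟩
        by_contra hx'; push Not at hx'
        exact hx'.1 (h q hq x hx (Ne.symm hqp) (Ne.symm hx'.2))
      · push Not at h2
        exact ⟨p, hp, fun x hx => Or.inl (h2 x hx)⟩
    obtain ⟨q, hq, hpq⟩ := this
    obtain ⟨m, hm, hmp, hmq⟩ := hgood p hp q hq
    refine hBad ⟨m, hm, fun ρ hρ => ?_⟩
    rcases hpq ρ hρ with rfl | rfl
    · exact hmp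
    · exact hmq
  obtain ⟨q, hq, r, hr, hpq, hqr, hrp⟩ := key3
  have hσeq : ∀ x ∈ σ, x = p ∨ x = q ∨ x = r := fun x hx => mem_three_of_card_le hcard hp hq hr hpq hqr hrp hx
  -- `m₁`: the common minimiser of `{p, q}` that is best at `r`
  set Apq := V.filter (fun m => (∀ m' ∈ V, pair p m ≤ pair p m') ∧ (∀ m' ∈ V, pair q m ≤ pair q m')) with hApq
  have hApqne : Apq.Nonempty := by
    obtain ⟨m, hm, h1, h2⟩ := hgood p hp q hq
    exact ⟨m, Finset.mem_filter.2 ⟨hm, h1, h2⟩⟩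
  obtain ⟨m₁, hm₁Apq, hm₁min⟩ := Apq.exists_min_image (fun m => pair r m) hApqne
  obtain ⟨hm₁V, hm₁p, hm₁q⟩ := Finset.mem_filter.1 hm₁Apq
  obtain ⟨m₂, hm₂V, hm₂q, hm₂r⟩ := hgood q hq r hr
  obtain ⟨m₃, hm₃V, hm₃p, hm₃r⟩ := hgood p hp r hr
  -- `m₁` is not minimal at `r`
  have hm₁r : pair r m₂ < pair r m₁ := by
    by_contra h; push Not at h
    have h' : ∀ m' ∈ V, pair r m₁ ≤ pair r m' := fun m' hm' => h.trans (hm₂r m' hm')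
    exact hBad ⟨m₁, hm₁V, fun ρ hρ => by
      rcases hσeq ρ hρ with rfl | rfl | rfl
      · exact hm₁p
      · exact hm₁q
      · exact h'⟩
  have hm₃r' : pair r m₃ < pair r m₁ := lt_of_le_of_lt (hm₃r m₂ hm₂V) hm₁r
  -- TAKEOVER #1 with the table `E := minimisers at q`, along `[p, r]`, from `m₁`
  set E := V.filter (fun m => ∀ m' ∈ V, pair q m ≤ pair q m') with hE
  have hm₁E : m₁ ∈ E := Finset.mem_filter.2 ⟨hm₁V, hm₁q⟩
  have hm₂E : m₂ ∈ E := Finset.mem_filter.2 ⟨hm₂V, hm₂q⟩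
  have hEV : ∀ m ∈ E, m ∈ V := fun m hm => (Finset.mem_filter.1 hm).1
  obtain ⟨m₄, hm₄E, A₁, B₁, hA₁, hB₁, hA₁eq, hB₁eq, hminE, htieE⟩ :=
    takeover E p r (fun m' hm' => hm₁p m' (hEV m' hm')) ⟨m₂, hm₂E, hm₁r⟩
  have hm₄V := hEV m₄ hm₄E
  have hm₄q := (Finset.mem_filter.1 hm₄E).2
  set y₁ := B₁ • p + A₁ • r with hy₁
  -- `A₁ > 0`
  have hA₁pos : 0 < A₁ := by
    rcases hA₁.lt_or_eq with h | h
    · exact h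
    · exfalso
      have hm₄Apq : m₄ ∈ Apq := Finset.mem_filter.2 ⟨hm₄V, fun m' hm' => by rw [hA₁eq, ← h, add_zero]; exact hm₁p m' hm', hm₄q⟩
      have := hm₁min m₄ hm₄Apq
      linarith
  -- `m₁` is not minimal (over `V`) at `y₁`: `m₃` beats it
  have hmb₂ : ∃ m' ∈ V, pair y₁ m' < pair y₁ m₁ := by
    refine ⟨m₃, hm₃V, ?_⟩
    rw [hy₁, pair_add, pair_add, pair_smul, pair_smul, pair_smul, pair_smul]
    nlinarith [hm₃p m₁ hm₁V]
  -- TAKEOVER #2 with the full table, along `[q, y₁]`, from `m₁`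
  obtain ⟨m₅, hm₅V, A₂, B₂, hA₂, hB₂, hA₂eq, hB₂eq, hmin₂, htie₂⟩ := takeover V q y₁ hm₁q hmb₂
  set y₂ := B₂ • q + A₂ • y₁ with hy₂
  -- `A₂ > 0`
  have hA₂pos : 0 < A₂ := by
    rcases hA₂.lt_or_eq with h | h
    · exact h
    · exfalso
      have hm₅E : m₅ ∈ E := Finset.mem_filter.2 ⟨hm₅V, fun m' hm' => by rw [hA₂eq, ← h, add_zero]; exact hm₁q m' hm'⟩
      have := hminE m₅ hm₅E
      linarith
  -- `m₄` is minimal at `y₂` too (ties with `m₁` at `q` and at `y₁`)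
  have htie₄ : pair y₂ m₄ = pair y₂ m₁ := by
    have h1 : pair q m₄ = pair q m₁ := le_antisymm (hm₄q m₁ hm₁V) (hm₁q m₄ hm₄V)
    rw [hy₂, pair_add, pair_add, pair_smul, pair_smul, pair_smul, pair_smul, h1, htieE]
  -- node point
  have hm₁₄ : m₁ ≠ m₄ := by intro h; rw [← h] at hB₁eq; linarith
  have hind : Indep (ND.rayOf m₄ - ND.rayOf m₁) (ND.rayOf m₅ - ND.rayOf m₁) := indep_of_takeover hm₁₄ htieE hB₂ hB₂eq
  have hnode : IsNodePoint V y₂ := ⟨m₁, hm₁V, m₄, hm₄V, m₅, hm₅V, hmin₂, htie₄, htie₂, hind⟩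
  -- coordinates of `y₂ = (A₂ B₁) p + B₂ q + (A₂ A₁) r`
  have hy₂exp : y₂ = (A₂ * B₁) • p + B₂ • q + (A₂ * A₁) • r := by
    rw [hy₂, hy₁, smul_add, smul_smul, smul_smul]; abel
  have hp0 := ND.ray_nonneg_of_isSmoothCone hσ hp
  have hq0 := ND.ray_nonneg_of_isSmoothCone hσ hq
  have hr0 := ND.ray_nonneg_of_isSmoothCone hσ hr
  have hy₂0 : ∀ i, 0 ≤ y₂ i := fun i => by
    rw [hy₂exp]; simp only [Pi.add_apply, Pi.smul_apply, smul_eq_mul]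
    have := hp0 i; have := hq0 i; have := hr0 i
    positivity
  have hy₂ne : y₂ ≠ 0 := by
    obtain ⟨i, hi⟩ := exists_pos_coord hq0 (ND.ray_ne_zero_of_isSmoothCone hσ hq)
    intro h0
    have e := congr_fun h0 i
    rw [hy₂exp] at e
    simp only [Pi.add_apply, Pi.smul_apply, smul_eq_mul, Pi.zero_apply] at e
    nlinarith [hp0 i, hr0 i, mul_pos hB₂ hi, mul_nonneg (mul_pos hA₂pos hB₁).le (hp0 i), mul_nonneg (mul_pos hA₂pos hA₁pos).le (hr0 i)]
  -- the node direction of `y₂` is a ray `ρ''` of the position; FAN EXCLUSION puts it in `σ`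
  obtain ⟨w, hw, a', b', ha', hb', hyw⟩ := exists_nodeDir hnode hy₂0 hy₂ne
  obtain ⟨σ'', hσ'', ρ'', hρ'', a'', b'', ha'', hb'', hwρ⟩ := hN w hw
  have hcomb : (b' * b'') • ρ'' = (a'' * a') • y₂ := by
    calc (b' * b'') • ρ'' = b' • (b'' • ρ'') := mul_smul _ _ _
      _ = b' • (a'' • w) := by rw [hwρ]
      _ = a'' • (b' • w) := smul_comm _ _ _
      _ = a'' • (a' • y₂) := by rw [hyw]
      _ = (a'' * a') • y₂ := (mul_smul _ _ _).symm
  set K := a'' * a' with hK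
  have hKpos : 0 < K := mul_pos ha'' ha'
  have hρ''σ : ρ'' ∈ σ :=
    mem_of_smul_eq_three hSep hσF hσ'' hρ'' (mul_pos hb' hb'') hp hq hr (cp := K * (A₂ * B₁)) (cq := K * B₂) (cr := K * (A₂ * A₁))
      (by positivity) (by positivity) (by positivity) (by rw [hcomb, hy₂exp, smul_add, smul_add, smul_smul, smul_smul, smul_smul])
  -- a non-trivial relation among the rays of `σ`
  obtain ⟨cy, hcydef⟩ : ∃ cy : Ray 3 → ℤ,
      cy = fun x => if x = p then K * (A₂ * B₁) else if x = q then K * B₂ else if x = r then K * (A₂ * A₁) else 0 := ⟨_, rfl⟩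
  have hcyp : cy p = K * (A₂ * B₁) := by rw [hcydef]; simp
  have hcyq : cy q = K * B₂ := by rw [hcydef]; simp [hpq.symm]
  have hcyr : cy r = K * (A₂ * A₁) := by rw [hcydef]; simp [hrp, hqr.symm]
  have hcy : ∑ x ∈ σ, cy x • x = K • y₂ := by
    rw [sum_three hp hq hr hpq hqr hrp cy (fun x _ h1 h2 h3 => by rw [hcydef]; simp [h1, h2, h3]), hcyp, hcyq, hcyr,
      hy₂exp, smul_add, smul_add, smul_smul, smul_smul, smul_smul]
  have hrel : ∑ x ∈ σ, ((if x = ρ'' then b' * b'' else 0) - cy x) • x = 0 := by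
    have h1 : ∑ x ∈ σ, ((if x = ρ'' then b' * b'' else 0 : ℤ)) • x = (b' * b'') • ρ'' := by
      rw [Finset.sum_congr rfl (fun x _ => by rw [ite_smul, zero_smul]), Finset.sum_ite_eq', if_pos hρ''σ]
    rw [Finset.sum_congr rfl (fun x _ => sub_smul _ _ x), Finset.sum_sub_distrib, h1, hcy, hcomb, hK, sub_self]
  have hzero := coeff_eq_zero_of_sum_smul_eq_zero hσ hrel
  -- compare coefficients at `q` and at `p`
  by_cases hρq : ρ'' = q
  · have h := hzero p hp
    rw [if_neg (by rw [hρq]; exact hpq), zero_sub, neg_eq_zero, hcyp] at h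
    have : 0 < K * (A₂ * B₁) := by positivity
    linarith
  · have h := hzero q hq
    rw [if_neg (Ne.symm hρq), zero_sub, neg_eq_zero, hcyq] at h
    have : 0 < K * B₂ := by positivity
    linarith

/-! ### Assembly -/

/-- PHASE 2 for a whole finite list of pairs, keeping earlier walls (fold). -/
theorem phase2_all (V : Finset (Fin 3 → ℕ)) (hV : V.Nonempty) (L : Finset ((Fin 3 → ℕ) × (Fin 3 → ℕ)))
    (hL : ∀ mm ∈ L, mm.1 ∈ V ∧ mm.2 ∈ V ∧ mm.1 ≠ mm.2) :
    ∀ F : Finset (Finset (Ray 3)), Reach V (orthantFan 3) F → NodesResolved V F →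
      ∃ F', Reach V F F' ∧ NodesResolved V F' ∧ ∀ mm ∈ L, NoWCross V mm.1 mm.2 F' := by
  classical
  induction L using Finset.induction_on with
  | empty => exact fun F _ hN => ⟨F, Reach.refl F, hN, fun mm hmm => absurd hmm (Finset.notMem_empty _)⟩
  | insert mm L hmmL ih =>
    intro F hR hN
    obtain ⟨F₁, hR₁, hN₁, hL₁⟩ := ih (fun mm' hmm' => hL mm' (Finset.mem_insert_of_mem hmm')) F hR hN
    have hR₁' : Reach V (orthantFan 3) F₁ := reach_trans V hR₁ hR
    obtain ⟨hm, hm', hne⟩ := hL mm (Finset.mem_insert_self _ _)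
    obtain ⟨F₂, hR₂, hN₂, hno⟩ := phase2_pair V hm hm' hne _ F₁ hR₁' hN₁ le_rfl
    refine ⟨F₂, reach_trans V hR₂ hR₁, hN₂, fun mm' hmm' => ?_⟩
    rcases Finset.mem_insert.1 hmm' with rfl | hmm'
    · exact hno
    · obtain ⟨h1, h2, h3⟩ := hL mm' (Finset.mem_insert_of_mem hmm')
      exact noWCross_of_reach hV hR₂ hR₁' hN₁ h1 h2 h3 (hL₁ mm' hmm')

/-- **FAN-GAME WINNABILITY IN DIMENSION THREE (the `FanGameLocal 3` shape).**  For every non-empty exponent table `V ⊂ ℕ³`, from every position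
reachable from the orthant by E1-legal stars some further E1-legal sequence of stars WINS: the monomial ideal `(x^m : m ∈ V)` is principalised by
smooth toric blow-ups whose centres lie in its non-principal locus.  Schedule «nodes first, then walls» (blueprint memo §6); every step kernel-checked.
[OURS · L1 W4.5b · D-0157 DOOR 1 WIDTH row iso-w4 — the row's theorem] -/
theorem fanGameWinnable_three (V : Finset (Fin 3 → ℕ)) (hV : V.Nonempty) {F : Finset (Finset (Ray 3))}
    (hR : Reach V (orthantFan 3) F) : ∃ F', Reach V F F' ∧ Won V F' := by
  classical
  obtain ⟨F₁, hR₁, hN₁⟩ := phase1 V hR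
  have hR₁' : Reach V (orthantFan 3) F₁ := reach_trans V hR₁ hR
  set L := (V ×ˢ V).filter (fun mm => mm.1 ≠ mm.2) with hL
  have hLmem : ∀ mm ∈ L, mm.1 ∈ V ∧ mm.2 ∈ V ∧ mm.1 ≠ mm.2 := fun mm hmm => by
    obtain ⟨h1, h2⟩ := Finset.mem_filter.1 hmm
    exact ⟨(Finset.mem_product.1 h1).1, (Finset.mem_product.1 h1).2, h2⟩
  obtain ⟨F₂, hR₂, hN₂, hno⟩ := phase2_all V hV L hLmem F₁ hR₁' hN₁
  have hR₂' : Reach V (orthantFan 3) F₂ := reach_trans V hR₂ hR₁'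
  refine ⟨F₂, reach_trans V hR₂ hR₁, fun σ hσ => ?_⟩
  exact not_bad_of_noWCross hV (separated_of_reach_orthant V hR₂') hN₂ hσ (ND.isSmoothCone_of_reach_orthant V hR₂' hσ)
    (card_le_three_of_reach_orthant le_rfl V hR₂' σ hσ)
    (fun m hm m' hm' hne u hu v hv => hno (m, m') (Finset.mem_filter.2 ⟨Finset.mem_product.2 ⟨hm, hm'⟩, hne⟩) σ hσ u hu v hv)

/-- **The row's statement** (desk WIDTH TABLE D1/D1′: «`∀ V, IsConvenientTable V → V.Nonempty → ∃ Φ', Reach V (orthantFan n) Φ' ∧ Won V Φ'`», `n = 3`;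
convenience is not even needed). [OURS · L1 W4.5b · row iso-w4] -/
theorem fanGameWinnable_three_orthant (V : Finset (Fin 3 → ℕ)) (hV : V.Nonempty) :
    ∃ F', Reach V (orthantFan 3) F' ∧ Won V F' :=
  fanGameWinnable_three V hV (Reach.refl _)

end FanGame

/-! ### Consequences for the ND lane: in three variables the won play is free -/

/-- **`LocalND ⇒ LocalNDWon` in three variables**: a convenient locally Newton-nondegenerate germ in `k[x,y,z]` HAS a won E1-legal play of its local fan
game — the `hND`-input of the registered ND stub needs no separate play at `n = 3`. [OURS · L1 W4.5b · row iso-w4] -/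
theorem localNDWon_of_localND_three {k : Type} [Field k] {g : MvPolynomial (Fin 3) k} (h : LocalND g) : LocalNDWon g :=
  ⟨h, FanGame.fanGameWinnable_three_orthant (table g) (ND.table_nonempty (ND.ne_zero_of_isLocallyND h.2))⟩

/-- **`IsoHypND ⇒ IsoHypNDWon` at `n = 3`**: the iso residue's hypothesis `¬ IsoHypNDWon k 3 H ι` is equivalent to `¬ IsoHypND k 3 H ι` («some
singular point has no convenient locally Newton-nondegenerate local equation in any polynomial coordinates») — the RE-CUT the row feeds.
[OURS · L1 W4.5b · row iso-w4] -/
theorem isoHypNDWon_of_isoHypND_three {k : Type} [Field k] [IsAlgClosed k] {H : AlgebraicGeometry.Scheme.{0}}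
    {ι : H ⟶ (Literature.AlgebraicGeometry.Motives.projectiveSpace 3 k).left} (hND : IsoHypND k 3 H ι) : IsoHypNDWon k 3 H ι := by
  obtain ⟨d, F, hF, hF0, hZ, h⟩ := hND
  refine ⟨d, F, hF, hF0, hZ, fun a ha hFa hda => ?_⟩
  obtain ⟨i, hi, θ, hθ, hL⟩ := h a ha hFa hda
  exact ⟨i, hi, θ, hθ, localNDWon_of_localND_three hL⟩

/-- The contrapositive used by the iso residue: NOT `IsoHypNDWon` ⇒ NOT `IsoHypND` (`n = 3`). [OURS · L1 W4.5b · row iso-w4] -/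
theorem not_isoHypND_of_not_isoHypNDWon_three {k : Type} [Field k] [IsAlgClosed k] {H : AlgebraicGeometry.Scheme.{0}}
    {ι : H ⟶ (Literature.AlgebraicGeometry.Motives.projectiveSpace 3 k).left} (h : ¬ IsoHypNDWon k 3 H ι) : ¬ IsoHypND k 3 H ι :=
  fun hND => h (isoHypNDWon_of_isoHypND_three hND)

end Summit.ResolutionOfSingularities.ResolutionOfSingularities.Cruxes.EquisingularLiftNat.Sections
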